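import Literature.NumberTheory.Congruences.BernoulliCharacterTeichmullerCongruence
import HarnessLib

/-!
# The Kummer congruence with a tame character on a RAMIFIED branch:
# `B_{1,χω^{a+k-1}} ≡ (1/k) B_{k,χω^{a}} (mod p)` for `a ≥ 1`, `k ≥ 1`, `(p−1) ∤ a + k`, `χ` modulo `N`, `p ∤ N`

Topic `Literature/NumberTheory/Congruences`; namespace
`Literature.NumberTheory.Congruences.CharacterTwist` (the namespace of the companion file
`BernoulliCharacterTeichmullerCongruence.lean`, whose §1–§2 machinery is reused).  THEOREMS ONLY (no
definition, no named fact, no instance).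

Let `p` be an odd prime, `ω` the Teichmüller character modulo `p` (`ω(a) ≡ a (mod p)`), `N ≥ 1` an
integer prime to `p`, `χ` a Dirichlet character modulo `N` with values in `ℚ_p`.  The companion file
proves Washington's congruence `L_p(0, θ) ≡ L_p(1 − k, θ) (mod p)` on the branch `θ = χω^k`, whose
index-`k` character `θω^{−k} = χ` has conductor PRIME TO `p`:  `B_{1,χω^{k-1}} ≡ (1/k) B_{k,χ}`.  Here is
the same congruence on a branch `θ = χω^{a+k}` with `ω^{a} ≠ 1` at index `k`, where BOTH characters
`θω^{−1} = χω^{a+k−1}` and `θω^{−k} = χω^{a}` have conductor DIVISIBLE BY `p` (so both Euler factors of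
Washington Thm. 5.11 are `1`):

  `‖B_{1,χω^{a+k-1}} − (1/k) B_{k,χω^{a}}‖_p < 1`,   `‖(1/k) B_{k,χω^{a}}‖_p ≤ 1`,

for `a ≥ 1`, `k ≥ 1` and `(p − 1) ∤ a + k` (the last condition makes Lang's prefactor
`1 − θ(c) = 1 − c^{a+k}` a `p`-unit for `c` a primitive root; it excludes no case of interest since
`(p−1) ∣ a + k` would put the branch at `θ = χ`).  Here `χω^{j}` is the character modulo `Np` (the
tree's `changeLevel χ * changeLevel (ω^j)`), `B_{·,·}` is the tree's `LFunctions.generalizedBernoulli`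
(Leopoldt's numbers at the level of the character, NOT of the primitive character it induces — for
`ω^{a} ≠ 1`, `ω^{a+k−1} ≠ 1` and `χ` primitive both characters ARE primitive of conductor `N p`), and
"`≡ (mod p)`" is `‖· − ·‖_p < 1`.  This is Washington Thm. 5.11 + Cor. 5.13 (`L_p(1−n, θ) =
−(1 − θω^{−n}(p)p^{n−1}) B_{n,θω^{−n}}/n`, `L_p(s,θ)` with coefficients in `ℤ_p` and constant mod `p` in
`s` for `θ ≠ 1`) at `n ∈ {1, k}`, `θ = χω^{a+k}`; equivalently Lang Ch. 4 §3 Thm. 3.2 with Ch. 2 §2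
Thm. 2.5.

USE (crux `PrintCFram.BottomClassIndexLawFiveLe`, line `eisenstein-resource-bdp-line`): with
`a = (p−1)/2` (so `χω^{a} = χ·(·/p)`, the twist of `χ` by the quadratic character of `ℚ(√−p)`) and
`k ∈ {(p+1)/4, (3p−1)/4}` one gets `(1/k)B_{k,χ·(·/p)} ≡ B_{1,χω^{p−1−k}} ≡ (1/(p−k))B_{p−k,χ}` — in
Cohen–Eisenstein terms `H(k, pN) ≡ H(p−k, N) (mod p)`: the class factor of the crux is a coefficient of
the weight-`k+1/2` series that carries the field factors.

ROAD: verbatim the companion file's (Lang's proof of Thm. 2.5 at tame level `Np`) with the twists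
`θ₁ = χ·ω^{a+k-1}` (index `1`) and `θ₂ = χ·ω^{a}` (index `k`); no level collapse is needed, the
integrands `x^0 θ₁(y)` and `x^{k-1} θ₂(y)` are congruent for `x ≡ y (mod p)` (both vanish when `p ∣ y`),
and with `c ≡ 1 (mod N)` a primitive root mod `p` both prefactors are `≡ 1 − c^{a+k}`, a `p`-unit.

Main statements (`hN : N.Coprime p`, `χ : DirichletCharacter ℚ_[p] N`, `ω` with `‖ω(a) − a‖_p < 1`
for `p ∤ a`, `1 ≤ a`, `1 ≤ k`, `¬ (p − 1 ∣ a + k)`):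

* `norm_generalizedBernoulli_div_le_one_ramified` — `‖(1/k) B_{k,χω^{a}}‖_p ≤ 1`;
* `norm_generalizedBernoulli_one_sub_div_lt_one_ramified` — **`‖B_{1,χω^{a+k-1}} − (1/k) B_{k,χω^{a}}‖_p < 1`**;
* `norm_generalizedBernoulli_one_le_one_ramified`, `norm_generalizedBernoulli_one_lt_one_iff_ramified`
  (`p ∣ B_{1,χω^{a+k-1}} ⟺ p ∣ (1/k) B_{k,χω^{a}}`, both as `‖·‖_p < 1`).

## Honest column

* SCOPE: as in the companion file, `χ` takes values in `ℚ_p`; TODO(general form): values in a finite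
  extension of `ℚ_p`.  The hypothesis `(p−1) ∤ a + k` is an artefact of Lang's auxiliary `c ≡ 1 (mod N)`
  (for `χ ≠ 1` the congruence also holds at `(p−1) ∣ a+k`, with a `c` such that `χ(c) ≠ 1`; not done).
  `a = 0` is the companion file (there the index-`k` character has level `N` and the level-`Np` sum
  must be collapsed; here it must not).
* Not here: higher congruences modulo `p^e`, the `p`-adic `L`-function itself, `p = 2`.

## References

* L. C. Washington, *Introduction to Cyclotomic Fields*, 2nd ed., GTM 83, Springer 1997, Thm. 5.11,
  Thm. 5.12, Cor. 5.13 (pp. 57–61). [Washington1997]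
* S. Lang, *Cyclotomic Fields I and II*, GTM 121, Springer 1990, Ch. 2 §2 Thms 2.2, 2.4, 2.5 and
  their proofs (PDF pp. 36–39); Ch. 4 §3 Thm. 3.2 (PDF p. 84). [LangCyclotomic1990]
-/

noncomputable section

open Finset Literature.NumberTheory.EllipticCurves Literature.NumberTheory.LFunctions
  DirichletCharacter

namespace Literature.NumberTheory.Congruences.CharacterTwist

variable {p : ℕ} [hp : Fact p.Prime]

section Ramified

variable {N : ℕ} [NeZero N]

/-- A multiple of `p` in `ℤ_p` has norm `≤ 1/p`. [folklore] -/
private theorem norm_le_inv_of_dvd' {z : ℤ_[p]} (hz : (p : ℤ_[p]) ∣ z) : ‖z‖ ≤ (p : ℝ)⁻¹ := by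
  obtain ⟨w, rfl⟩ := hz
  rw [norm_mul, PadicInt.norm_p]
  exact mul_le_of_le_one_right (inv_nonneg.mpr (Nat.cast_nonneg p)) (PadicInt.norm_le_one w)

/-- Transport of a level written in two ways. [folklore] -/
private theorem sum_level_eq' {L L' : ℕ} [NeZero L] [NeZero L'] (h : L = L')
    (F : (T : ℕ) → ZMod T → ℚ_[p]) :
    ∑ b : ZMod L, F L b = ∑ b : ZMod L', F L' b := by
  subst h
  rfl

/-- `‖1 − c^n‖_p = 1` when `p ∤ 1 − c^n`. [folklore] -/
private theorem norm_one_sub_pow_eq_one' {c n : ℕ} (h : ¬ ((p : ℤ) ∣ (1 - (c : ℤ) ^ n))) :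
    ‖(1 - (c : ℚ_[p]) ^ n)‖ = 1 := by
  have h1 := Padic.norm_int_le_one (p := p) (1 - (c : ℤ) ^ n)
  have h' : ¬ ‖((1 - (c : ℤ) ^ n : ℤ) : ℚ_[p])‖ < 1 := by
    rw [Padic.norm_intCast_lt_one_iff]
    exact h
  push_cast at h1 h'
  exact le_antisymm h1 (not_lt.mp h')

omit [NeZero N] in
/-- **`p ∤ 1 − c^n` for every `n` with `(p−1) ∤ n`**, when `c^j ≢ 1 (mod p)` for all `0 < j < p − 1`
(a primitive root: reduce `n` modulo `p − 1` by Fermat). [cite: LangCyclotomic1990, Ch. 2 §2, proof of Thm. 2.5 ("c a primitive root mod p")] -/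
theorem not_dvd_one_sub_pow_of_not_dvd {c : ℕ} (hc : c.Coprime p)
    (hck : ∀ j : ℕ, 0 < j → j < p - 1 → ¬ ((p : ℤ) ∣ (1 - (c : ℤ) ^ j)))
    {n : ℕ} (hn : ¬ (p - 1 ∣ n)) : ¬ ((p : ℤ) ∣ (1 - (c : ℤ) ^ n)) := by
  have hpp := hp.out
  have hp1 : 0 < p - 1 := by have := hpp.two_le; omega
  set r := n % (p - 1) with hr
  have hr0 : 0 < r := Nat.pos_of_ne_zero fun h ↦ hn (Nat.dvd_of_mod_eq_zero h)
  have hrp : r < p - 1 := Nat.mod_lt _ hp1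
  intro hdvd
  apply hck r hr0 hrp
  -- in `ZMod p`: `c^n = c^r` since `c^{p-1} = 1`
  have hc0 : (c : ZMod p) ≠ 0 := by
    rw [Ne, ZMod.natCast_eq_zero_iff]
    intro h
    exact hpp.ne_one ((Nat.coprime_comm.mp hc).eq_one_of_dvd h)
  have hF : (c : ZMod p) ^ (p - 1) = 1 := ZMod.pow_card_sub_one_eq_one hc0
  have hpow : (c : ZMod p) ^ n = (c : ZMod p) ^ r := by
    conv_lhs => rw [← Nat.div_add_mod n (p - 1), pow_add, pow_mul, hF, one_pow, one_mul]
  rw [← ZMod.intCast_zmod_eq_zero_iff_dvd] at hdvd ⊢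
  push_cast at hdvd ⊢
  rwa [hpow] at hdvd

/-- **`(1/k) B_{k,χω^{a}}` is `p`-integral** for `χ` modulo `N`, `p ∤ N`, `1 ≤ a`, `1 ≤ k`,
`(p−1) ∤ a + k` (the integrality half of Lang's argument on the ramified branch:
`(1/k)(1 − ω^{a}(c)c^k) B_{k,χω^{a}} = ∫ χω^{a} x^{k-1} dE_{1,c}` is a `p`-adic integer and
`1 − ω^{a}(c)c^k ≡ 1 − c^{a+k}` is a `p`-unit; Washington Thm. 5.12/Cor. 5.13: `L_p(1−k, χω^{a+k}) ∈ ℤ_p`).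
[cite: LangCyclotomic1990, Ch. 2 §2, Thm. 2.4 and the proof of Thm. 2.5] [cite: Washington1997, Thm. 5.11 and Cor. 5.13] -/
theorem norm_generalizedBernoulli_div_le_one_ramified (hN : N.Coprime p)
    (χ : DirichletCharacter ℚ_[p] N) (ω : DirichletCharacter ℚ_[p] p)
    (hω : ∀ a : ℤ, ¬ ((p : ℤ) ∣ a) → ‖ω (a : ZMod p) - (a : ℚ_[p])‖ < 1)
    {a k : ℕ} (ha : 1 ≤ a) (hk : 1 ≤ k) (hak : ¬ (p - 1 ∣ a + k)) :
    ‖(k : ℚ_[p])⁻¹ * generalizedBernoulli k (changeLevel (dvd_mul_right N p) χ *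
        changeLevel (dvd_mul_left p N) (ω ^ a))‖ ≤ 1 := by
  have hp2 : p ≠ 2 := by
    intro h2
    apply hak
    rw [h2]
    exact one_dvd _
  have hp1 : (1 : ℝ) < p := by exact_mod_cast hp.out.one_lt
  have ha0 : a ≠ 0 := by omega
  obtain ⟨c, hc, hc1, hck⟩ := exists_auxiliary (p := p) hN
  have hcp : c.Coprime p := Nat.Coprime.coprime_mul_left_right hc
  have hcpZ : ¬ ((p : ℤ) ∣ (c : ℤ)) := by
    rw [Int.natCast_dvd_natCast, ← hp.out.coprime_iff_not_dvd]
    exact hcp.symm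
  set ψ : DirichletCharacter ℚ_[p] p := ω ^ a with hψ
  -- the twist `θ₂ = χ·ω^a`, an `Np`-periodic function with values in `ℤ_p`
  set θ : ℕ → ℤ_[p] := fun b ↦ ⟨χ (b : ZMod N) * ψ (b : ZMod p),
    (norm_mul_le _ _).trans (mul_le_one₀ (norm_apply_le_one χ _) (norm_nonneg _)
      (norm_apply_le_one ψ _))⟩ with hθ_def
  have hθ : ∀ b, θ (b + N * p) = θ b := fun b ↦ by
    apply PadicInt.ext
    simp only [hθ_def, Nat.cast_add, Nat.cast_mul, ZMod.natCast_self, zero_mul, mul_zero,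
      add_zero]
  have hθc : ∀ x, θ (c * x) = θ c * θ x := fun x ↦ by
    apply PadicInt.ext
    simp only [hθ_def, Nat.cast_mul, map_mul, PadicInt.coe_mul]
    ring
  have hM := bernoulliMeasure_zero_eq p (N := N * p) (θ := θ) hc hθ hθc k
  have hNp : N * p * p ^ 0 = N * p := by rw [pow_zero, mul_one]
  have h0 : ∑ b : ZMod (N * p * p ^ 0), ((θ b.val : ℤ_[p]) : ℚ_[p]) *
      ((bernoulliDist k (N * p * p ^ 0) b : ℚ) : ℚ_[p]) =
      ∑ b : ZMod (N * p), ((θ b.val : ℤ_[p]) : ℚ_[p]) * ((bernoulliDist k (N * p) b : ℚ) : ℚ_[p]) :=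
    sum_level_eq' hNp (fun T b ↦ ((θ b.val : ℤ_[p]) : ℚ_[p]) * ((bernoulliDist k T b : ℚ) : ℚ_[p]))
  have hsum : ∑ b : ZMod (N * p * p ^ 0), ((θ b.val : ℤ_[p]) : ℚ_[p]) *
      ((bernoulliDist k (N * p * p ^ 0) b : ℚ) : ℚ_[p]) =
      generalizedBernoulli k (changeLevel (dvd_mul_right N p) χ *
        changeLevel (dvd_mul_left p N) ψ) := by
    rw [h0, generalizedBernoulli_mul_eq_sum hk]
  have hθcv : ((θ c : ℤ_[p]) : ℚ_[p]) = ψ (c : ZMod p) := by simp [hθ_def, hc1]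
  rw [hsum, hθcv] at hM
  have hint := TeichmullerTwist.norm_bernoulliMeasure_zero_le_one (N := N * p) (θ := θ) (k := k)
    hp2 hc hθ hk
  -- the prefactor `1 − ω^a(c) c^k ≡ 1 − c^{a+k}` is a unit
  set u₂ : ℚ_[p] := 1 - ψ (c : ZMod p) * (c : ℚ_[p]) ^ k with hu₂
  have hv : ‖(1 - (c : ℚ_[p]) ^ (a + k))‖ = 1 :=
    norm_one_sub_pow_eq_one' (not_dvd_one_sub_pow_of_not_dvd hcp hck hak)
  have hu₂v : ‖u₂ - (1 - (c : ℚ_[p]) ^ (a + k))‖ < 1 := by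
    have e : u₂ - (1 - (c : ℚ_[p]) ^ (a + k)) = (c : ℚ_[p]) ^ k * ((c : ℚ_[p]) ^ a - ψ (c : ZMod p)) := by
      rw [hu₂, pow_add]; ring
    rw [e, norm_mul]
    have hc1n : ‖(c : ℚ_[p]) ^ k‖ ≤ 1 := by
      rw [norm_pow]
      exact pow_le_one₀ (norm_nonneg _) (by exact_mod_cast Padic.norm_int_le_one (c : ℤ))
    have hω' : ‖(c : ℚ_[p]) ^ a - ψ (c : ZMod p)‖ < 1 := by
      set C : ℤ_[p] := ⟨ω ((c : ℤ) : ZMod p), norm_apply_le_one ω _⟩ with hC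
      have hCc : (p : ℤ_[p]) ∣ C - (c : ℤ_[p]) := by
        rw [← PadicInt.norm_lt_one_iff_dvd, PadicInt.norm_def, PadicInt.coe_sub]
        simpa [hC] using hω c hcpZ
      have hd : (p : ℤ_[p]) ∣ C ^ a - (c : ℤ_[p]) ^ a := dvd_trans hCc (sub_dvd_pow_sub_pow _ _ _)
      have hn : ‖C ^ a - (c : ℤ_[p]) ^ a‖ < 1 :=
        (norm_le_inv_of_dvd' hd).trans_lt (inv_lt_one_of_one_lt₀ hp1)
      rw [PadicInt.norm_def, PadicInt.coe_sub, PadicInt.coe_pow, PadicInt.coe_pow] at hn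
      rw [← norm_neg, neg_sub, hψ, MulChar.pow_apply' _ ha0]
      simpa [hC, Int.cast_natCast] using hn
    calc ‖(c : ℚ_[p]) ^ k‖ * ‖(c : ℚ_[p]) ^ a - ψ (c : ZMod p)‖
        ≤ 1 * ‖(c : ℚ_[p]) ^ a - ψ (c : ZMod p)‖ := by gcongr
      _ < 1 := by rw [one_mul]; exact hω'
  have hu₂n : ‖u₂‖ = 1 := by
    have e : u₂ = (1 - (c : ℚ_[p]) ^ (a + k)) + (u₂ - (1 - (c : ℚ_[p]) ^ (a + k))) := by ring
    rw [e, IsUltrametricDist.norm_add_eq_max_of_norm_ne_norm, hv, max_eq_left hu₂v.le]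
    rw [hv]
    exact (ne_of_lt hu₂v).symm
  have e : bernoulliMeasure p (N * p) c θ k 0 0 =
      u₂ * ((k : ℚ_[p])⁻¹ * generalizedBernoulli k (changeLevel (dvd_mul_right N p) χ *
        changeLevel (dvd_mul_left p N) ψ)) := by
    rw [hM, hu₂]; ring
  rw [e, norm_mul, hu₂n, one_mul] at hint
  exact hint

/-- **Washington Thm. 5.11 + Cor. 5.13 on the ramified branch `θ = χω^{a+k}`:
`B_{1,χω^{a+k-1}} ≡ (1/k) B_{k,χω^{a}} (mod p)`.**  For an odd prime `p`, `N` prime to `p`, a Dirichlet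
character `χ` modulo `N` with values in `ℚ_p`, the Teichmüller character `ω` modulo `p`
(`‖ω(a) − a‖_p < 1` for `p ∤ a`), `1 ≤ a`, `1 ≤ k` and `(p−1) ∤ a + k`:
`‖B_{1,χω^{a+k-1}} − (1/k) B_{k,χω^{a}}‖_p < 1`, where `χω^{j}` is the character
`changeLevel χ * changeLevel ω^{j}` modulo `Np` and `B_{·,·}` is the tree's
`LFunctions.generalizedBernoulli` (both Euler factors `1 − θω^{−n}(p)p^{n−1}` of Washington's formula are
`1`, the characters having conductor divisible by `p`).
[cite: Washington1997, Thm. 5.11 and Cor. 5.13] [cite: LangCyclotomic1990, Ch. 2 §2, Thms 2.4–2.5 and their proofs; Ch. 4 §3 Thm. 3.2] -/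
theorem norm_generalizedBernoulli_one_sub_div_lt_one_ramified (hN : N.Coprime p)
    (χ : DirichletCharacter ℚ_[p] N) (ω : DirichletCharacter ℚ_[p] p)
    (hω : ∀ a : ℤ, ¬ ((p : ℤ) ∣ a) → ‖ω (a : ZMod p) - (a : ℚ_[p])‖ < 1)
    {a k : ℕ} (ha : 1 ≤ a) (hk : 1 ≤ k) (hak : ¬ (p - 1 ∣ a + k)) :
    ‖generalizedBernoulli 1 (changeLevel (dvd_mul_right N p) χ *
          changeLevel (dvd_mul_left p N) (ω ^ (a + k - 1))) -
        (k : ℚ_[p])⁻¹ * generalizedBernoulli k (changeLevel (dvd_mul_right N p) χ *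
          changeLevel (dvd_mul_left p N) (ω ^ a))‖ < 1 := by
  have hp2 : p ≠ 2 := by
    intro h2
    apply hak
    rw [h2]
    exact one_dvd _
  have hp1 : (1 : ℝ) < p := by exact_mod_cast hp.out.one_lt
  have ha0 : a ≠ 0 := by omega
  have hak0 : a + k - 1 ≠ 0 := by omega
  obtain ⟨c, hc, hc1, hck⟩ := exists_auxiliary (p := p) hN
  have hcp : c.Coprime p := Nat.Coprime.coprime_mul_left_right hc
  have hcpZ : ¬ ((p : ℤ) ∣ (c : ℤ)) := by
    rw [Int.natCast_dvd_natCast, ← hp.out.coprime_iff_not_dvd]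
    exact hcp.symm
  set ψ₁ : DirichletCharacter ℚ_[p] p := ω ^ (a + k - 1) with hψ₁
  set ψ₂ : DirichletCharacter ℚ_[p] p := ω ^ a with hψ₂
  -- the two twists, as `Np`-periodic functions on `ℕ` with values in `ℤ_p`
  set θ : ℕ → ℤ_[p] := fun b ↦ ⟨χ (b : ZMod N) * ψ₁ (b : ZMod p),
    (norm_mul_le _ _).trans (mul_le_one₀ (norm_apply_le_one χ _) (norm_nonneg _)
      (norm_apply_le_one ψ₁ _))⟩ with hθ_def
  set θ' : ℕ → ℤ_[p] := fun b ↦ ⟨χ (b : ZMod N) * ψ₂ (b : ZMod p),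
    (norm_mul_le _ _).trans (mul_le_one₀ (norm_apply_le_one χ _) (norm_nonneg _)
      (norm_apply_le_one ψ₂ _))⟩ with hθ'_def
  have hθ : ∀ b, θ (b + N * p) = θ b := fun b ↦ by
    apply PadicInt.ext
    simp only [hθ_def, Nat.cast_add, Nat.cast_mul, ZMod.natCast_self, zero_mul, mul_zero,
      add_zero]
  have hθ' : ∀ b, θ' (b + N * p) = θ' b := fun b ↦ by
    apply PadicInt.ext
    simp only [hθ'_def, Nat.cast_add, Nat.cast_mul, ZMod.natCast_self, zero_mul, mul_zero,
      add_zero]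
  have hθc : ∀ x, θ (c * x) = θ c * θ x := fun x ↦ by
    apply PadicInt.ext
    simp only [hθ_def, Nat.cast_mul, map_mul, PadicInt.coe_mul]
    ring
  have hθ'c : ∀ x, θ' (c * x) = θ' c * θ' x := fun x ↦ by
    apply PadicInt.ext
    simp only [hθ'_def, Nat.cast_mul, map_mul, PadicInt.coe_mul]
    ring
  -- congruence of the integrands: `x^0 θ(y) ≡ x^{k-1} θ'(y) (mod p)` for `x ≡ y (mod p)`
  have H : ∀ x y : ℕ, x ≡ y [MOD p] →
      ‖((x : ℤ_[p]) ^ 0 * θ y - (x : ℤ_[p]) ^ (k - 1) * θ' y)‖ ≤ (p : ℝ)⁻¹ := by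
    intro x y hxy
    refine norm_le_inv_of_dvd' ?_
    by_cases hy : (p : ℤ) ∣ (y : ℤ)
    · -- both sides vanish: `ψ₁(y) = ψ₂(y) = 0`
      have hy0 : ((y : ℕ) : ZMod p) = 0 := by
        rw [← Int.cast_natCast, ZMod.intCast_zmod_eq_zero_iff_dvd]
        exact hy
      have hψ₁0 : ψ₁ (0 : ZMod p) = 0 := ψ₁.map_nonunit not_isUnit_zero
      have hψ₂0 : ψ₂ (0 : ZMod p) = 0 := ψ₂.map_nonunit not_isUnit_zero
      have hθy : θ y = 0 := by
        apply PadicInt.ext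
        simp [hθ_def, hy0, hψ₁0]
      have hθ'y : θ' y = 0 := by
        apply PadicInt.ext
        simp [hθ'_def, hy0, hψ₂0]
      rw [hθy, hθ'y, mul_zero, mul_zero, sub_zero]
      exact dvd_zero _
    · -- `p ∤ y`: `ψ₁(y) = ω(y)^{a}·ω(y)^{k-1} ≡ ω(y)^{a}·x^{k-1}`
      set Y : ℤ_[p] := ⟨ω ((y : ℤ) : ZMod p), norm_apply_le_one ω _⟩ with hY
      have hYy : (p : ℤ_[p]) ∣ Y - (y : ℤ_[p]) := by
        rw [← PadicInt.norm_lt_one_iff_dvd, PadicInt.norm_def, PadicInt.coe_sub]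
        simpa [hY] using hω y hy
      have hyx : (p : ℤ_[p]) ∣ (y : ℤ_[p]) - (x : ℤ_[p]) := by
        have h := map_dvd (Int.castRingHom ℤ_[p]) hxy.dvd
        simpa using h
      have hYx : (p : ℤ_[p]) ∣ Y - (x : ℤ_[p]) := by
        have h := dvd_add hYy hyx
        rwa [sub_add_sub_cancel] at h
      have hYxk : (p : ℤ_[p]) ∣ Y ^ (k - 1) - (x : ℤ_[p]) ^ (k - 1) :=
        dvd_trans hYx (sub_dvd_pow_sub_pow _ _ _)
      set X₀ : ℤ_[p] := ⟨χ (y : ZMod N), norm_apply_le_one χ _⟩ with hX₀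
      have hθy : θ y = X₀ * Y ^ (a + k - 1) := by
        apply PadicInt.ext
        simp [hθ_def, hX₀, hY, hψ₁, MulChar.pow_apply' _ hak0]
      have hθ'y : θ' y = X₀ * Y ^ a := by
        apply PadicInt.ext
        simp [hθ'_def, hX₀, hY, hψ₂, MulChar.pow_apply' _ ha0]
      have e : Y ^ (a + k - 1) = Y ^ a * Y ^ (k - 1) := by
        rw [← pow_add]
        congr 1
        omega
      have e2 : (x : ℤ_[p]) ^ 0 * (X₀ * (Y ^ a * Y ^ (k - 1))) - (x : ℤ_[p]) ^ (k - 1) * (X₀ * Y ^ a) =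
          (X₀ * Y ^ a) * (Y ^ (k - 1) - (x : ℤ_[p]) ^ (k - 1)) := by ring
      rw [hθy, e, hθ'y, e2]
      exact Dvd.dvd.mul_left hYxk _
  -- congruence and integrality of the total masses
  have hcong := norm_bernoulliMeasure_zero_sub_lt_one_level (M := N * p) (c := c) (θ := θ)
    (θ' := θ') hp2 hc hθ hθ' (i := 0) (j := k - 1) H
  rw [zero_add, Nat.sub_add_cancel hk] at hcong
  have hint' := TeichmullerTwist.norm_bernoulliMeasure_zero_le_one (N := N * p) (θ := θ') (k := k)
    hp2 hc hθ' hk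
  -- the total masses by Thm. 2.4
  have hM := bernoulliMeasure_zero_eq p (N := N * p) (θ := θ) hc hθ hθc 1
  have hM' := bernoulliMeasure_zero_eq p (N := N * p) (θ := θ') hc hθ' hθ'c k
  have hNp : N * p * p ^ 0 = N * p := by rw [pow_zero, mul_one]
  have h0 : ∑ b : ZMod (N * p * p ^ 0), ((θ b.val : ℤ_[p]) : ℚ_[p]) *
      ((bernoulliDist 1 (N * p * p ^ 0) b : ℚ) : ℚ_[p]) =
      ∑ b : ZMod (N * p), ((θ b.val : ℤ_[p]) : ℚ_[p]) * ((bernoulliDist 1 (N * p) b : ℚ) : ℚ_[p]) :=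
    sum_level_eq' hNp (fun T b ↦ ((θ b.val : ℤ_[p]) : ℚ_[p]) * ((bernoulliDist 1 T b : ℚ) : ℚ_[p]))
  have h0' : ∑ b : ZMod (N * p * p ^ 0), ((θ' b.val : ℤ_[p]) : ℚ_[p]) *
      ((bernoulliDist k (N * p * p ^ 0) b : ℚ) : ℚ_[p]) =
      ∑ b : ZMod (N * p), ((θ' b.val : ℤ_[p]) : ℚ_[p]) * ((bernoulliDist k (N * p) b : ℚ) : ℚ_[p]) :=
    sum_level_eq' hNp (fun T b ↦ ((θ' b.val : ℤ_[p]) : ℚ_[p]) * ((bernoulliDist k T b : ℚ) : ℚ_[p]))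
  have hsum : ∑ b : ZMod (N * p * p ^ 0), ((θ b.val : ℤ_[p]) : ℚ_[p]) *
      ((bernoulliDist 1 (N * p * p ^ 0) b : ℚ) : ℚ_[p]) =
      generalizedBernoulli 1 (changeLevel (dvd_mul_right N p) χ *
        changeLevel (dvd_mul_left p N) ψ₁) := by
    rw [h0, generalizedBernoulli_mul_eq_sum le_rfl]
  have hsum' : ∑ b : ZMod (N * p * p ^ 0), ((θ' b.val : ℤ_[p]) : ℚ_[p]) *
      ((bernoulliDist k (N * p * p ^ 0) b : ℚ) : ℚ_[p]) =
      generalizedBernoulli k (changeLevel (dvd_mul_right N p) χ *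
        changeLevel (dvd_mul_left p N) ψ₂) := by
    rw [h0', generalizedBernoulli_mul_eq_sum hk]
  have hθcv : ((θ c : ℤ_[p]) : ℚ_[p]) = ψ₁ (c : ZMod p) := by simp [hθ_def, hc1]
  have hθ'cv : ((θ' c : ℤ_[p]) : ℚ_[p]) = ψ₂ (c : ZMod p) := by simp [hθ'_def, hc1]
  rw [hsum, hθcv, Nat.cast_one, inv_one, one_mul, pow_one] at hM
  rw [hsum', hθ'cv] at hM'
  -- names
  set X := generalizedBernoulli 1 (changeLevel (dvd_mul_right N p) χ *
    changeLevel (dvd_mul_left p N) ψ₁) with hX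
  set Y := (k : ℚ_[p])⁻¹ * generalizedBernoulli k (changeLevel (dvd_mul_right N p) χ *
    changeLevel (dvd_mul_left p N) ψ₂) with hY
  set u₁ : ℚ_[p] := 1 - ψ₁ (c : ZMod p) * (c : ℚ_[p]) with hu₁
  set u₂ : ℚ_[p] := 1 - ψ₂ (c : ZMod p) * (c : ℚ_[p]) ^ k with hu₂
  set v : ℚ_[p] := 1 - (c : ℚ_[p]) ^ (a + k) with hv_def
  have hμ : bernoulliMeasure p (N * p) c θ 1 0 0 = u₁ * X := by rw [hM]
  have hμ' : bernoulliMeasure p (N * p) c θ' k 0 0 = u₂ * Y := by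
    rw [hM', hY, hu₂]
    ring
  -- `v = 1 − c^{a+k}` is a `p`-unit and `u₁ ≡ v ≡ u₂ (mod p)`
  have hvn : ‖v‖ = 1 := norm_one_sub_pow_eq_one' (not_dvd_one_sub_pow_of_not_dvd hcp hck hak)
  -- `‖c^j − ω^j(c)‖ < 1`
  have hωpow : ∀ {j : ℕ}, j ≠ 0 → ‖(c : ℚ_[p]) ^ j - (ω ^ j) (c : ZMod p)‖ < 1 := by
    intro j hj
    set C : ℤ_[p] := ⟨ω ((c : ℤ) : ZMod p), norm_apply_le_one ω _⟩ with hC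
    have hCc : (p : ℤ_[p]) ∣ C - (c : ℤ_[p]) := by
      rw [← PadicInt.norm_lt_one_iff_dvd, PadicInt.norm_def, PadicInt.coe_sub]
      simpa [hC] using hω c hcpZ
    have hd : (p : ℤ_[p]) ∣ C ^ j - (c : ℤ_[p]) ^ j := dvd_trans hCc (sub_dvd_pow_sub_pow _ _ _)
    have hn : ‖C ^ j - (c : ℤ_[p]) ^ j‖ < 1 :=
      (norm_le_inv_of_dvd' hd).trans_lt (inv_lt_one_of_one_lt₀ hp1)
    rw [PadicInt.norm_def, PadicInt.coe_sub, PadicInt.coe_pow, PadicInt.coe_pow] at hn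
    rw [← norm_neg, neg_sub, MulChar.pow_apply' _ hj]
    simpa [hC, Int.cast_natCast] using hn
  have hcn : ∀ j : ℕ, ‖(c : ℚ_[p]) ^ j‖ ≤ 1 := fun j ↦ by
    rw [norm_pow]
    exact pow_le_one₀ (norm_nonneg _) (by exact_mod_cast Padic.norm_int_le_one (c : ℤ))
  have hu₁v : ‖u₁ - v‖ < 1 := by
    have e : u₁ - v = (c : ℚ_[p]) * ((c : ℚ_[p]) ^ (a + k - 1) - ψ₁ (c : ZMod p)) := by
      rw [hu₁, hv_def]
      have : (c : ℚ_[p]) ^ (a + k) = (c : ℚ_[p]) * (c : ℚ_[p]) ^ (a + k - 1) := by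
        rw [← pow_succ', Nat.sub_add_cancel (by omega : 1 ≤ a + k)]
      rw [this]
      ring
    rw [e, norm_mul]
    calc ‖(c : ℚ_[p])‖ * ‖(c : ℚ_[p]) ^ (a + k - 1) - ψ₁ (c : ZMod p)‖
        ≤ 1 * ‖(c : ℚ_[p]) ^ (a + k - 1) - ψ₁ (c : ZMod p)‖ := by
          gcongr
          simpa using hcn 1
      _ < 1 := by rw [one_mul, hψ₁]; exact hωpow hak0
  have hu₂v : ‖u₂ - v‖ < 1 := by
    have e : u₂ - v = (c : ℚ_[p]) ^ k * ((c : ℚ_[p]) ^ a - ψ₂ (c : ZMod p)) := by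
      rw [hu₂, hv_def, pow_add]; ring
    rw [e, norm_mul]
    calc ‖(c : ℚ_[p]) ^ k‖ * ‖(c : ℚ_[p]) ^ a - ψ₂ (c : ZMod p)‖
        ≤ 1 * ‖(c : ℚ_[p]) ^ a - ψ₂ (c : ZMod p)‖ := by gcongr; exact hcn k
      _ < 1 := by rw [one_mul, hψ₂]; exact hωpow ha0
  have hsub : ∀ x y : ℚ_[p], ‖x - y‖ ≤ max ‖x‖ ‖y‖ := fun x y ↦ by
    simpa only [sub_eq_add_neg, norm_neg] using IsUltrametricDist.norm_add_le_max x (-y)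
  have hu₁₂ : ‖u₁ - u₂‖ < 1 := by
    have e : u₁ - u₂ = (u₁ - v) - (u₂ - v) := by ring
    rw [e]
    exact (hsub _ _).trans_lt (max_lt hu₁v hu₂v)
  have hunit : ∀ {u : ℚ_[p]}, ‖u - v‖ < 1 → ‖u‖ = 1 := by
    intro u huv
    have e : u = v + (u - v) := by ring
    rw [e, IsUltrametricDist.norm_add_eq_max_of_norm_ne_norm, hvn, max_eq_left huv.le]
    rw [hvn]
    exact (ne_of_lt huv).symm
  have hu₁n : ‖u₁‖ = 1 := hunit hu₁v
  have hu₂n : ‖u₂‖ = 1 := hunit hu₂v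
  have hu₁0 : u₁ ≠ 0 := norm_pos_iff.mp (by rw [hu₁n]; exact one_pos)
  -- `Y` is `p`-integral
  have hYn : ‖Y‖ ≤ 1 := by
    have h := hint'
    rw [hμ', norm_mul, hu₂n, one_mul] at h
    exact h
  -- `X − Y = u₁⁻¹ ((μ − μ') + (u₂ − u₁) Y)`
  have e : X - Y = u₁⁻¹ * ((bernoulliMeasure p (N * p) c θ 1 0 0 -
      bernoulliMeasure p (N * p) c θ' k 0 0) + (u₂ - u₁) * Y) := by
    rw [hμ, hμ']
    field_simp
    ring
  rw [e, norm_mul, norm_inv, hu₁n, inv_one, one_mul]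
  refine (IsUltrametricDist.norm_add_le_max _ _).trans_lt (max_lt hcong ?_)
  rw [norm_mul]
  calc ‖u₂ - u₁‖ * ‖Y‖ ≤ ‖u₂ - u₁‖ * 1 := by gcongr
    _ < 1 := by rw [mul_one, ← norm_neg, neg_sub]; exact hu₁₂

/-- **`B_{1,χω^{a+k-1}}` is `p`-integral** (`1 ≤ a`, `1 ≤ k`, `(p−1) ∤ a+k`, `p ∤ N`): from the
congruence and the integrality of `(1/k)B_{k,χω^{a}}`. [cite: Washington1997, Thm. 5.11 and Cor. 5.13] [cite: LangCyclotomic1990, Ch. 2 §2, Thm. 2.5 and Cor. 1 of Thm. 2.3] -/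
theorem norm_generalizedBernoulli_one_le_one_ramified (hN : N.Coprime p)
    (χ : DirichletCharacter ℚ_[p] N) (ω : DirichletCharacter ℚ_[p] p)
    (hω : ∀ a : ℤ, ¬ ((p : ℤ) ∣ a) → ‖ω (a : ZMod p) - (a : ℚ_[p])‖ < 1)
    {a k : ℕ} (ha : 1 ≤ a) (hk : 1 ≤ k) (hak : ¬ (p - 1 ∣ a + k)) :
    ‖generalizedBernoulli 1 (changeLevel (dvd_mul_right N p) χ *
        changeLevel (dvd_mul_left p N) (ω ^ (a + k - 1)))‖ ≤ 1 := by
  have h1 := norm_generalizedBernoulli_one_sub_div_lt_one_ramified hN χ ω hω ha hk hak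
  have h2 := norm_generalizedBernoulli_div_le_one_ramified hN χ ω hω ha hk hak
  set X := generalizedBernoulli 1 (changeLevel (dvd_mul_right N p) χ *
    changeLevel (dvd_mul_left p N) (ω ^ (a + k - 1)))
  set Y := (k : ℚ_[p])⁻¹ * generalizedBernoulli k (changeLevel (dvd_mul_right N p) χ *
    changeLevel (dvd_mul_left p N) (ω ^ a))
  have e : X = (X - Y) + Y := by ring
  rw [e]
  exact (IsUltrametricDist.norm_add_le_max _ _).trans (max_le h1.le h2)

/-- **`p ∣ B_{1,χω^{a+k-1}} ⟺ p ∣ (1/k) B_{k,χω^{a}}`** (`1 ≤ a`, `1 ≤ k`, `(p−1) ∤ a+k`, `p ∤ N`), both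
divisibilities read as `‖·‖_p < 1` on the `p`-integral numbers of the two previous theorems.
[cite: Washington1997, Thm. 5.11 and Cor. 5.13] [cite: LangCyclotomic1990, Ch. 2 §2, Thm. 2.5] -/
theorem norm_generalizedBernoulli_one_lt_one_iff_ramified (hN : N.Coprime p)
    (χ : DirichletCharacter ℚ_[p] N) (ω : DirichletCharacter ℚ_[p] p)
    (hω : ∀ a : ℤ, ¬ ((p : ℤ) ∣ a) → ‖ω (a : ZMod p) - (a : ℚ_[p])‖ < 1)
    {a k : ℕ} (ha : 1 ≤ a) (hk : 1 ≤ k) (hak : ¬ (p - 1 ∣ a + k)) :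
    ‖generalizedBernoulli 1 (changeLevel (dvd_mul_right N p) χ *
        changeLevel (dvd_mul_left p N) (ω ^ (a + k - 1)))‖ < 1 ↔
      ‖(k : ℚ_[p])⁻¹ * generalizedBernoulli k (changeLevel (dvd_mul_right N p) χ *
        changeLevel (dvd_mul_left p N) (ω ^ a))‖ < 1 := by
  have h1 := norm_generalizedBernoulli_one_sub_div_lt_one_ramified hN χ ω hω ha hk hak
  set X := generalizedBernoulli 1 (changeLevel (dvd_mul_right N p) χ *
    changeLevel (dvd_mul_left p N) (ω ^ (a + k - 1)))
  set Y := (k : ℚ_[p])⁻¹ * generalizedBernoulli k (changeLevel (dvd_mul_right N p) χ *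
    changeLevel (dvd_mul_left p N) (ω ^ a))
  have hsub : ∀ x y : ℚ_[p], ‖x - y‖ ≤ max ‖x‖ ‖y‖ := fun x y ↦ by
    simpa only [sub_eq_add_neg, norm_neg] using IsUltrametricDist.norm_add_le_max x (-y)
  constructor
  · intro hX
    have e : Y = X - (X - Y) := by ring
    rw [e]
    exact (hsub _ _).trans_lt (max_lt hX h1)
  · intro hY
    have e : X = (X - Y) + Y := by ring
    rw [e]
    exact (IsUltrametricDist.norm_add_le_max _ _).trans_lt (max_lt h1 hY)

end Ramified

end Literature.NumberTheory.Congruences.CharacterTwist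

end
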